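import Mathlib.LinearAlgebra.Matrix.SpecialLinearGroup
import Mathlib.LinearAlgebra.Matrix.Notation
import Literature.Combinatorics.Additive.TripleProductProperty
import Literature.Computability.AlgebraicComplexity.CohnUmansTPP
import HarnessLib

/-!
# Cohn–Umans 2003, Prop. 5.1: `SL₂(𝔽_q)` realizes `⟨q, q, q⟩`

Topic `Literature/Computability/AlgebraicComplexity` (group-theoretic matrix multiplication), namespace
`Literature.Computability.AlgebraicComplexity`; companion of `CohnUmansTPP.lean` (`RealizesTPP`).

H. Cohn, C. Umans, *A group-theoretic approach to fast matrix multiplication*, FOCS 2003 = arXiv:math/0307321, §5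
"Linear groups" (Proposition 10 of the arXiv text, p. 7): "**Proposition 5.1.** The group `SL₂(𝔽_q)` of order
`q³ − q` realizes `⟨q, q, q⟩`. … *Proof.* Consider the three parabolic subgroups
`H₁ = {(1 x; 0 1) : x ∈ 𝔽_q}`, `H₂ = {(1 0; y 1) : y ∈ 𝔽_q}`, and `H₃ = {(1+z z; −z 1−z) : z ∈ 𝔽_q}`. We need to
check that for `hᵢ ∈ Hᵢ`, if `h₁h₂ = h₃`, then `h₁ = h₂ = h₃ = 1`. To check that, we multiply to get
`(1+xy x; y 1) = (1+z z; −z 1−z)`, which implies `1 = 1 − z`, so `z = 0`, from which `x = y = 0` follows."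
("Unfortunately, this pseudo-exponent bound tends to `3` as `q → ∞`, but at least it is always strictly better
than `3`.")

## Lean rendering
Over any commutative ring `R`: the three one-parameter subgroups as homomorphisms `Multiplicative R →* SL(2, R)`
(`upperHom`, `lowerHom`, `mixedHom`; `H₃` is a subgroup because `(1+z z; −z 1−z) = 1 + zN` with `N² = 0`), the printed
computation `CohnUmans2003_prop51_eq` (`h₁h₂ = h₃ ⇒ x = y = z = 0`), and for a finite commutative ring `R` with `q`
elements (the paper: `R = 𝔽_q`): **`CohnUmans2003_prop51 : RealizesTPP (SL(2,R)) q q q`** (tree's right-quotient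
TPP; for subgroups it agrees with the subgroup form, `tpp_image_of_homs'`). The order `q³ − q` is not restated.

## References
* H. Cohn, C. Umans, FOCS 2003, 438–449; arXiv:math/0307321, §5, Prop. 5.1 (Prop. 10 of the arXiv text, p. 7).
  [CohnUmans2003]
-/

namespace Literature.Computability.AlgebraicComplexity

open Finset Matrix Literature.Combinatorics.Additive

section Ring

variable {R : Type*} [CommRing R]

/-- `H₁`: `x ↦ (1 x; 0 1)`. [cite: CohnUmans2003, Prop. 5.1 (proof; Prop. 10 of the arXiv text)] -/
def upperHom : Multiplicative R →* SpecialLinearGroup (Fin 2) R where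
  toFun x := ⟨!![1, x.toAdd; 0, 1], by simp [Matrix.det_fin_two_of]⟩
  map_one' := by
    ext i j; fin_cases i <;> fin_cases j <;> simp
  map_mul' x y := by
    ext i j
    fin_cases i <;> fin_cases j <;>
      simp [Matrix.mul_apply, Fin.sum_univ_two, add_comm]

/-- `H₂`: `y ↦ (1 0; y 1)`. [cite: CohnUmans2003, Prop. 5.1 (proof; Prop. 10 of the arXiv text)] -/
def lowerHom : Multiplicative R →* SpecialLinearGroup (Fin 2) R where
  toFun y := ⟨!![1, 0; y.toAdd, 1], by simp [Matrix.det_fin_two_of]⟩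
  map_one' := by
    ext i j; fin_cases i <;> fin_cases j <;> simp
  map_mul' x y := by
    ext i j
    fin_cases i <;> fin_cases j <;>
      simp [Matrix.mul_apply, Fin.sum_univ_two, add_comm]

/-- `H₃`: `z ↦ (1+z z; −z 1−z)` (`= 1 + zN`, `N = (1 1; −1 −1)`, `N² = 0`).
[cite: CohnUmans2003, Prop. 5.1 (proof; Prop. 10 of the arXiv text)] -/
def mixedHom : Multiplicative R →* SpecialLinearGroup (Fin 2) R where
  toFun z := ⟨!![1 + z.toAdd, z.toAdd; -z.toAdd, 1 - z.toAdd], by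
    simp [Matrix.det_fin_two_of]; ring⟩
  map_one' := by
    ext i j; fin_cases i <;> fin_cases j <;> simp
  map_mul' x y := by
    ext i j
    fin_cases i <;> fin_cases j <;>
      simp [Matrix.mul_apply, Fin.sum_univ_two] <;> ring

/-- **The printed computation**: `(1 x; 0 1)(1 0; y 1) = (1+xy x; y 1) = (1+z z; −z 1−z)` forces `z = 0` and
then `x = y = 0`. [cite: CohnUmans2003, Prop. 5.1 (proof; Prop. 10 of the arXiv text, p. 7)] -/
theorem CohnUmans2003_prop51_eq (x y z : Multiplicative R)
    (h : upperHom x * lowerHom y = mixedHom z) : x = 1 ∧ y = 1 ∧ z = 1 := by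
  have h' := congrArg (fun g : SpecialLinearGroup (Fin 2) R => (g : Matrix (Fin 2) (Fin 2) R)) h
  simp only [upperHom, lowerHom, mixedHom, MonoidHom.coe_mk, OneHom.coe_mk,
    SpecialLinearGroup.coe_mul] at h'
  have h11 := congrFun (congrFun h' 1) 1
  have h01 := congrFun (congrFun h' 0) 1
  have h10 := congrFun (congrFun h' 1) 0
  simp [Matrix.mul_apply, Fin.sum_univ_two] at h11 h01 h10
  -- `h11 : 1 = 1 - z`, `h01 : x = z`, `h10 : y = -z`
  have hz : Multiplicative.toAdd z = 0 := by linear_combination h11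
  refine ⟨?_, ?_, ?_⟩
  · exact toAdd_eq_zero.1 (by rw [h01, hz])
  · exact toAdd_eq_zero.1 (by rw [h10, hz, neg_zero])
  · exact toAdd_eq_zero.1 hz

end Ring

/-- For subgroups (`Q(Hᵢ) = Hᵢ`) the tree's right-quotient TPP of three homomorphic images follows from the subgroup
form "`h₁h₂ = h₃` forces `hᵢ = 1`" ("An equivalent formulation replaces `h₁h₂h₃ = 1` with `h₁h₂ = h₃`").
[cite: CohnUmans2003, Def. 2.1 (remark after it)] -/
private theorem tpp_image_of_homs' {K G : Type*} [Group K] [Group G] [Fintype K] [DecidableEq G]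
    (φ₁ φ₂ φ₃ : K →* G) (h : ∀ a b c : K, φ₁ a * φ₂ b = φ₃ c → a = 1 ∧ b = 1 ∧ c = 1) :
    TripleProductProperty (univ.image φ₁) (univ.image φ₂) (univ.image φ₃) := by
  intro s hs s' hs' t ht t' ht' u hu u' hu' heq
  obtain ⟨a, -, rfl⟩ := mem_image.1 hs
  obtain ⟨a', -, rfl⟩ := mem_image.1 hs'
  obtain ⟨b, -, rfl⟩ := mem_image.1 ht
  obtain ⟨b', -, rfl⟩ := mem_image.1 ht'
  obtain ⟨c, -, rfl⟩ := mem_image.1 hu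
  obtain ⟨c', -, rfl⟩ := mem_image.1 hu'
  have key : φ₁ (a * a'⁻¹) * φ₂ (b * b'⁻¹) = φ₃ (c' * c⁻¹) := by
    rw [map_mul, map_inv, map_mul, map_inv, map_mul, map_inv]
    calc φ₁ a * (φ₁ a')⁻¹ * (φ₂ b * (φ₂ b')⁻¹)
        = φ₁ a * (φ₁ a')⁻¹ * (φ₂ b * (φ₂ b')⁻¹) * (φ₃ c * (φ₃ c')⁻¹) * (φ₃ c * (φ₃ c')⁻¹)⁻¹ := by group
      _ = φ₃ c' * (φ₃ c)⁻¹ := by rw [heq]; group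
  obtain ⟨h1, h2, h3⟩ := h _ _ _ key
  exact ⟨by rw [mul_inv_eq_one.1 h1], by rw [mul_inv_eq_one.1 h2], by rw [mul_inv_eq_one.1 h3]⟩

/-- **Cohn–Umans 2003, Prop. 5.1**: for a finite commutative ring `R` with `q` elements (the paper: `R = 𝔽_q`),
`SL₂(R)` realizes `⟨q, q, q⟩` through the three subgroups `H₁, H₂, H₃`.
[cite: CohnUmans2003, Prop. 5.1 (Prop. 10 of the arXiv text, p. 7)] -/
theorem CohnUmans2003_prop51 (R : Type*) [CommRing R] [Fintype R] [DecidableEq R] :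
    RealizesTPP (SpecialLinearGroup (Fin 2) R) (Fintype.card R) (Fintype.card R) (Fintype.card R) := by
  have h1 : Function.Injective (upperHom (R := R)) := fun x y h => by
    have := congrArg (fun g : SpecialLinearGroup (Fin 2) R => (g : Matrix (Fin 2) (Fin 2) R) 0 1) h
    simpa [upperHom] using this
  have h2 : Function.Injective (lowerHom (R := R)) := fun x y h => by
    have := congrArg (fun g : SpecialLinearGroup (Fin 2) R => (g : Matrix (Fin 2) (Fin 2) R) 1 0) h
    simpa [lowerHom] using this
  have h3 : Function.Injective (mixedHom (R := R)) := fun x y h => by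
    have := congrArg (fun g : SpecialLinearGroup (Fin 2) R => (g : Matrix (Fin 2) (Fin 2) R) 0 1) h
    simpa [mixedHom] using this
  refine ⟨univ.image upperHom, univ.image lowerHom, univ.image mixedHom, ?_, ?_, ?_,
    tpp_image_of_homs' _ _ _ CohnUmans2003_prop51_eq⟩
  · rw [card_image_of_injective _ h1, card_univ, Fintype.card_multiplicative]
  · rw [card_image_of_injective _ h2, card_univ, Fintype.card_multiplicative]
  · rw [card_image_of_injective _ h3, card_univ, Fintype.card_multiplicative]

end Literature.Computability.AlgebraicComplexity
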